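import Summits.RiemannHypothesis.RiemannHypothesis.Theorems.WindowTraceArch.Negative.ComplexSpectrum
import Literature.NumberTheory.LFunctions.SimpleZeros
import HarnessLib

/-!
# `SpectralIsHpSpectrum` — counting the canonical spectrum (zeta ordinates with multiplicity)

Helper file for the crux `stmt-RiemannHypothesis-0195`
(`Summit.RiemannHypothesis.RiemannHypothesis.Theses.SpectralTrace.SpectralIsHpSpectrum`), line
`self-majorant-peak` (lead's skeleton `Cruxes/SpectralIsHpSpectrum/Lines/self-majorant-peak.lean`,
STUB 2 `stub_encardOrdinatesFibre`). Pure bookkeeping, no analysis: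

* `riemannZetaZeroOrder_eq_analyticOrderNatAt` — for `s ≠ 1` the explicit formula's multiplicity
  `m(s) = riemannZetaZeroOrder s` (a meromorphic order read in `ℤ`) is Mathlib's
  `analyticOrderNatAt ζ s` (the crux's multiplicity).
* `encard_ordinates_fibre` — under RH, among the non-trivial zeros repeated `m(ρ)` times (the
  index type `Σ ρ, Fin m(ρ)` of `hasSum_weilMellin_zeros`), the `encard` of those with `Im ρ = τ`
  is `𝟙_{non-trivial zeros}(1/2+iτ) · analyticOrderNatAt ζ (1/2+iτ)`: under RH `ρ = 1/2 + i Im ρ`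
  (`eq_half_add_of_riemannHypothesis`), so the fibre is the copy of `Fin m(1/2+iτ)` over that
  point when it is a zero, and empty otherwise.
* `stub_encardOrdinatesFibre` — the registered stub, verbatim.

References: E. C. Titchmarsh, The Theory of the Riemann Zeta-Function (1986), §2.12, ch. 9
(multiplicities of zeros); the tree's `ZetaZeros` / `SimpleZeros` API.
-/

noncomputable section

open Complex Set Filter

namespace Summit.RiemannHypothesis.RiemannHypothesis.Theorems.SpectralIsHpSpectrum

open Literature.NumberTheory.LFunctions
open Summit.RiemannHypothesis.RiemannHypothesis.Theorems.WindowTraceArch.Negative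

/-- `m(s) = analyticOrderNatAt ζ s` (cast to `ℤ`) for every `s ≠ 1`: the explicit formula's
multiplicity `riemannZetaZeroOrder` is the crux's multiplicity (finite analytic order away from
the pole, `analyticOrderAt_riemannZeta_ne_top`). [folklore] -/
theorem riemannZetaZeroOrder_eq_analyticOrderNatAt {s : ℂ} (hs : s ≠ 1) :
    riemannZetaZeroOrder s = (analyticOrderNatAt riemannZeta s : ℤ) := by
  have ha : AnalyticAt ℂ riemannZeta s := analyticOn_riemannZeta s hs
  obtain ⟨n, hn⟩ := ENat.ne_top_iff_exists.mp (analyticOrderAt_riemannZeta_ne_top hs)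
  rw [riemannZetaZeroOrder, ha.meromorphicOrderAt_eq, ← hn, ENat.map_coe, WithTop.untop₀_coe,
    analyticOrderNatAt, ← hn, ENat.toNat_coe]

/-- A point `1/2 + iτ` of the critical line is not the pole. [folklore] -/
theorem half_add_ne_one (τ : ℝ) : (1 / 2 : ℂ) + τ * I ≠ 1 := by
  intro h
  have := congrArg Complex.re h
  norm_num at this

/-- **Fibre `encard` of the canonical family.** Under RH, among the non-trivial zeros repeated
with multiplicity, the `encard` of those with `Im ρ = τ` is the indicator-multiplicity of the
crux at `1/2 + iτ`: the fibre is the range of `Sigma.mk ⟨1/2+iτ, _⟩` on `Fin m(1/2+iτ)` when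
`1/2 + iτ` is a non-trivial zero (`eq_half_add_of_riemannHypothesis`), and empty otherwise.
[folklore] -/
theorem encard_ordinates_fibre (hRH : _root_.RiemannHypothesis) (τ : ℝ) :
    {p : (Σ ρ : ZetaZeros.riemannZetaNontrivialZeros, Fin (riemannZetaZeroOrder (ρ : ℂ)).toNat) |
        (p.1 : ℂ).im = τ}.encard =
      ZetaZeros.riemannZetaNontrivialZeros.indicator
        (fun w => (analyticOrderNatAt riemannZeta w : ℕ∞)) (1 / 2 + τ * I) := by
  set s : ℂ := 1 / 2 + τ * I with hs_def
  have hs1 : s ≠ 1 := half_add_ne_one τ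
  by_cases hz : s ∈ ZetaZeros.riemannZetaNontrivialZeros
  · have hset : {p : (Σ ρ : ZetaZeros.riemannZetaNontrivialZeros,
        Fin (riemannZetaZeroOrder (ρ : ℂ)).toNat) | (p.1 : ℂ).im = τ} =
        Set.range (Sigma.mk (β := fun ρ : ZetaZeros.riemannZetaNontrivialZeros =>
          Fin (riemannZetaZeroOrder (ρ : ℂ)).toNat) ⟨s, hz⟩) := by
      ext p
      simp only [Set.mem_setOf_eq, Set.mem_range]
      constructor
      · intro hp
        obtain ⟨ρ, c⟩ := p
        have hρ : ρ = ⟨s, hz⟩ := by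
          apply Subtype.ext
          have h1 := eq_half_add_of_riemannHypothesis hRH ρ
          simp only at hp
          rw [← h1, hp]
        subst hρ
        exact ⟨c, rfl⟩
      · rintro ⟨c, rfl⟩
        simp [hs_def]
    rw [hset, Set.indicator_of_mem hz, ← (Set.finite_range _).cast_ncard_eq,
      Set.ncard_range_of_injective sigma_mk_injective, Nat.card_eq_fintype_card, Fintype.card_fin]
    have h1 : ((riemannZetaZeroOrder s).toNat : ℤ) = (analyticOrderNatAt riemannZeta s : ℤ) := by
      rw [← riemannZetaZeroOrder_eq_analyticOrderNatAt hs1]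
      exact Int.toNat_of_nonneg (riemannZetaZeroOrder_nonneg hs1)
    have h2 : (riemannZetaZeroOrder s).toNat = analyticOrderNatAt riemannZeta s := by exact_mod_cast h1
    rw [h2]
  · have hset : {p : (Σ ρ : ZetaZeros.riemannZetaNontrivialZeros,
        Fin (riemannZetaZeroOrder (ρ : ℂ)).toNat) | (p.1 : ℂ).im = τ} = ∅ := by
      ext p
      simp only [Set.mem_setOf_eq, Set.mem_empty_iff_false, iff_false]
      intro hp
      apply hz
      have h1 := eq_half_add_of_riemannHypothesis hRH p.1
      rw [hp] at h1
      rw [hs_def, h1]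
      exact p.1.2
    rw [hset, Set.encard_empty, Set.indicator_of_notMem hz]

/-! ### The registered stub of the lead's skeleton (`Cruxes/SpectralIsHpSpectrum/Lines/self-majorant-peak.lean`) -/

/-- **STUB 2 of the line `self-majorant-peak` (`stub_encardOrdinatesFibre`, registered on
stmt-RiemannHypothesis-0195), verbatim** — `encard_ordinates_fibre`. [folklore] -/
theorem stub_encardOrdinatesFibre :
    _root_.RiemannHypothesis → ∀ τ : ℝ,
      {p : (Σ ρ : ZetaZeros.riemannZetaNontrivialZeros, Fin (riemannZetaZeroOrder (ρ : ℂ)).toNat) |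
          (p.1 : ℂ).im = τ}.encard =
        ZetaZeros.riemannZetaNontrivialZeros.indicator
          (fun w => (analyticOrderNatAt riemannZeta w : ℕ∞)) (1 / 2 + τ * I) :=
  fun hRH τ => encard_ordinates_fibre hRH τ

end Summit.RiemannHypothesis.RiemannHypothesis.Theorems.SpectralIsHpSpectrum

end
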